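import Literature.MathematicalPhysics.QuantumFieldTheory.Balaban1983to89.B16Ineq197RelCubes
import Literature.MathematicalPhysics.QuantumFieldTheory.Balaban1983to89.B16Ineq197XBudget
import Literature.MathematicalPhysics.QuantumFieldTheory.Balaban1983to89.B16Count196Packing

/-!
# `Balaban1983to89.B16Ineq197Window` (v1.2) — the COMBINED WINDOW COROLLARY: all five lattice leaves of the cell's typed
(1.91) ⇒ (1.97) bookkeeping `…B16Ineq197.Polymer` ([Balaban1989LargeFieldII] pp. 388–390) on ONE carrier, unit b01's
ℤ^d windows `…B14.RelTreeLength.Window d`, from ONE typed LATTICE MODEL of a polymer (`Model`: every incidence a named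
field, nothing asserted) and ONE list of clauses on the constants (`Clauses`), composed BY NAME from the four instance
modules of this lineage — `Subadd193` ← `…B16Ineq197RelGlue.subadd193_window`, `Vol193` ← `…B16Ineq197RelCubes.vol193_window`,
`Anch194` ← `…B16Ineq197RelCubes.anch194_window`, `XBudget` ← `…B16Ineq197XBudget.xBudget_of_treeLen`, `Count196` ←
`…B16Count196Packing.count196_of_packing` — with the CONSISTENT size conventions (tree cost `treeX j = treeLen (comp j) + 2`,
the unique choice meeting RelGlue's `treeLen + 2 ≤ treeX` and XBudget's `treeX ≤ treeLen + 2`; `vol j = #(comp j)`;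
`dY = W.relSys.dRel`; `v = #(X′∖L)`), and then fed into unit b02's `…B16Ineq197.ineq197_of_leaves` to conclude the quoted
leaf `B16.Ineq197` of `B16.lean` on a window's relative domain system (`ineq197_window`); a non-vacuity witness on a
two-cube window of ℤ¹ on which the model, the clauses AND `Consts.Small` hold simultaneously with b01's genuine constants
`kapparel`/`Krel` (`Toy.toy_ineq197`).

CITATION HEADER (lean-in-tree rule 2026-08-18).  Source under audit (cell paper B16): T. Bałaban, *Large field
renormalization. II. Localization, exponentiation, and bounds for the 𝐑 operation*, Commun. Math. Phys. **122**, 355–392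
(1989), doi:10.1007/bf01238433 [Balaban1989LargeFieldII] (held `paper:balaban1989-cmp122-large-field-ii`; journal page =
PDF page + 354).  NO NEW QUOTATION is introduced by this module: the printed displays (1.91)–(1.96), pp. 388–389 (renders
`…1989-cmp122-large-field-II-p034/p035-x2.png` read as images), are quoted verbatim in the headers of the imported modules
`…B16Ineq197` (v1.1), `…B16Ineq197RelGlue`, `…B16Ineq197RelCubes`, `…B16Ineq197XBudget`, `…B16Count196Packing` (each
cross-read by a seat outside this lineage: cell journal l.48710, l.51503 ∕ l.51613, l.51214, l.52202, l.50807), and the conclusion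
(1.97), p. 389–390 [PDF 35–36], is quoted verbatim in the docstring of `B16.Ineq197` (`B16.lean` v13): *"|F(X′)| ≤ c₁
exp(−(1+β)κ d_{k,∪Y_i}(X′)), (1.97) where c₁ = exp(−p₀(g_k)) if X′ does not intersect ⋃_{i=1}^m Y_i, and c₁ = α^{1/3} in
the remaining cases."*  The Bałaban papers are manuscripts UNDER ADJUDICATION by the audit cell `pub-balaban`: NOTHING
printed in them is asserted here; every lattice incidence of pp. 377/385–389 that the cell READS into (1.93)–(1.96) (GAPS
C-adv6-51 (1)–(4), C-adv7-85, C-adv7-86, SMALLNESS S-B16.12/S-B16.13) is a FIELD of the hypothesis structure `Model` or of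
`Clauses`, i.e. a binder of every theorem, to be discharged by the joiner on a typed carrier of the 𝐑-operation.

THE DICTIONARY (one window W of b01 for the large-field cubes, a cube family L for the cubes of ⋃Y_i; revised v1.2 after
the cross-read of v1/v1.1, cell journal l.53020, REMARK R1 + INFO I1/I2).  `W.Z` ↔ the large-field region Z of the step
inside the window — the union of its class-1 components X_1,…,X_n and class-2 components Y_1,…,Y_m (p. 378, as READ in
cell GAPS C-adv7-85 (a)).  Print's Z′ = ⋃_{i=1}^m Y_i ∪ ⋃_{h=1}^q X_{j_h} (p. 388, the line after (1.92), quoted in the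
header of `B16Ineq197`) is defined PER TERM of (1.91); but under the cell's certified reading C-adv7-85 (a) — Z′ ⊂ Z, and
Z ∩ X′ ⊂ Z′ because all n factors 𝐓′_k(X_j) of (1.72) are present in every Mayer term (p. 387: every class-1 component
inside the connected component X′ is one of its X_{j_h}) and a localization domain Y of the expansion contains every
component of Z~ ⊇ Z it meets (p. 377; on the window this is the closure clause of b01's `Window.IsAdm`, p. 262 [III]) —
one has Y ∩ Z′ = Y ∩ Z for every Y ∈ 𝐃 (Y ⊂ X′) and X′∖Z′ = X′∖Z: the term-dependence of Z′ is invisible to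
d_{k,Z′}(Y) (= d_{k,Z}(Y), as the typed reading of `B16Ineq197` already records), to the small parts Y∖Z′ and to the
anchors of (1.94).  Hence ONE window set serves every polymer and every admissible pair — the p-independence of
`B16Ineq197.Polymer.dY` and of the cover ∕ cut ∕ anchor geometry of `Model` loses nothing under that reading — and the
rate d_{k,W.Z}(Y) of the binder `Major192` is literally the rate d_{k,Z}(Y) of (1.68).  §2′ below makes this
kernel-visible over TERM-SHAPED binders (nothing printed asserted): from (i) X′ ⊆ ⋃_{j∈S} X_j ∪ ⋃_{Y∈𝐃} Y (the pair
determines X′), (ii) a catalogued Y contains every class-1 component it meets (a THEOREM for Y in b01's resummed class,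
`subset_of_isAdm_of_meets`) and (iii) every class-1 component inside X′ is selected, follow Z ∩ X′ ⊆ ⋃Y_i ∪ ⋃_{j∈S} X_j
(`largeField_inter_subset`, `largeField_inter_subset_window`), Y ∩ Z′ = Y ∩ Z (`inter_zprime_eq`), d_{k,Z′}(Y) =
`W.relSys.dRel Y` for every term and every Y of the term (`dRel_eq_of_inter_eq`, `dRel_term_eq`), and the model's fields `cover` (`cover_of_term`) and `anchor`
(`anchor_of_sdiff_nonempty`, from Y∖Z~ ≠ ∅, p. 377, with ⋃Y_i ∪ Z ⊆ Z~).  A joiner working instead with a reading in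
which some X_j ⊂ X′ may be absent from S would need W.Z ⊇ Z′_S on each Y for `Major192` (d_rel is antitone in the
removed set) and the class-1 cubes of X′ inside W.Z to lie in ⋃_{j∈S} X_j for `cover`; b01's window theorems are uniform
in the window, so indexing W by the pair would then be a mechanical generalisation (REMARK R1).  `W.Z` enters `dY Y =
W.relSys.dRel Y = relTreeLen Y (Y∖W.Z)` (d_{k,Z}(Y), (1.67)), the covering small parts `Y∖W.Z` of the 𝐃-members, and
the anchors of (1.94) (cells of X′∖L outside W.Z, print *"|X′∖Z′| ≤ |X′∖∪Y_i|"* as quoted in `B16Ineq197`).  `L` ↔ the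
cubes of ⋃Y_i (L ⊆ W.Z in the intended model, so that `anchor`'s clause a ∉ L is implied by a ∉ W.Z): it enters `dX ≤
relTreeLen X′ (X′∖L)` (d_{k,∪Y_i}(X′)), `v = #(X′∖L)` (M^{−d}|X′∖∪Y_i|), the cover `X′∖L ⊆ ⋃_{j∈S} X_j ∪
⋃_{Y∈𝐃}(Y∖W.Z)`, and `X_j ⊆ X′∖L` (pairwise disjoint, each of ≥ n cubes: (1.96)).  In `ineq197_window` the polymers X′
range over the domains of a SECOND window `WL` on the same cube lattice with `L := WL.Z`, so that `WL.relSys.dRel =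
d_{k,∪Y_i}` and `WL.relSys.MeetsLF X′ = "X′ ∩ ⋃Y_i ≠ ∅"` is the printed c₁-selector of (1.97) (`B16.RelDomainSys`
docstring).  Only `WL.B`, `WL.Z` and `WL.relSys` of the second window are used — `WL.Omega`, `WL.Lam0` carry no meaning
(any cube family Z₀ ⊆ B is the `Z` of the window (B, Ω := B, Λ := B∖Z₀, Λ⁰ := ∅), cf. `Toy.toyW`; INFO I1) — and "same
cube lattice" is NOT enforced as `WL.B = W.B`: a polymer satisfies `X.1 ⊆ WL.B` by its type and `subset_B : X.1 ⊆ W.B`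
as a field (INFO I2).  `WL = W` (⋃Y_i = Z: no class-1 component in the window) is allowed and is the toy's case (Z = ∅).

WHAT IS PROVED (no `sorry`, no new axioms; [folklore] = elementary bookkeeping): the §2′ lemmas `sdiff_eq_sdiff_of_inter_eq`,
`dRel_eq_of_inter_eq`, `subset_of_isAdm_of_meets`, `largeField_inter_subset`, `largeField_inter_subset_window`,
`inter_zprime_eq`, `dRel_term_eq`, `cover_of_term`, `anchor_of_sdiff_nonempty` (v1.2: one window set for every term, as above);
`clauses_four_printed` (v1.1: the clauses at
d = 4 from the printed shapes V = (100R)^4, n = R^4, ρ = 100^4·R^{−4}, a₁, a₀ ≥ 64, ½βκ ≥ 4215, β(1+lam) ≤ ½, E ≥ 2κ(100R)^4,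
C₁ ≥ Krel(64, 80) — by b01's `Window.kapparel_four_lt`, `B16Ineq197XBudget.clause_of_two_mul_le`, `B16Count196Packing.inv_pow_le_printed`), `Model.subadd193`, `Model.vol193`,
`Model.xBudget`, `Model.anch194`, `Model.count196` (each leaf from the model and the clauses it needs), `Model.leaves` (the
five-leaf conjunction from `Model`, `Consts.Small`, `Clauses` and `dX ≤ relTreeLen X′ (X′∖L)`), `ineq197_window` ((1.92) as the
binder `Major192` + a model for every polymer + the two selector facts ⇒ `B16.Ineq197 WL.relSys dom F p₀ α β κ`, by
`ineq197_of_leaves`), and the witness `Toy.toy_ineq197` (window B = Ω = Λ = two adjacent cubes of ℤ¹, Λ⁰ = ∅, Z = ∅; for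
every domain X the polymer with the single class-1 component X, v = #X, treeX = treeLen X + 2; constants β = 1, lam = 1/16,
a₁ = a₀ = 8 = 4·2¹, cJ = 2, C₁ = Krel(8, 2), κ = max(64, 2·kapparel(8, 2), 64·Krel(8, 2)), E = (6 + ⅛)κ, p₀ = 2E, β₀ = s = 0,
ρ = n = 1, V = 2, α = exp(−(27/2)κ) so that α^{1/3}·exp((1+β)κcJ + lam·βκ·a₀) = 1; the term is the (1.92) majorant θ^{#S} ≠ 0).
NOT PROVED ∕ open at the lattice level (joiner): the CONSTRUCTION of a `Model` for the polymers of the actual 𝐑-operation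
(class-1 geometry pp. 385–387, the admissibility of the catalogued Y in b01's resummed class, the cut condition, the volume
bound V = (100R_k)^d and the MR_k-cube content n = R_k^d of the X_j), the majorant (1.92) (`Major192`, derived in
`B16Ineq197` Part B from the schematic operator bound only), and the selector facts; the printed numbers are NOT shown to
satisfy `Consts.Small` here (only the shapes of `Clauses` at d = 4, `clauses_four_printed`; the numeric clauses 4215 ≤ ½βκ,
β(1+lam) ≤ ½, … are the cell's SMALLNESS S-B16.12/S-B16.13 business and stay binders).  Value: the (1.91) ⇒ (1.97)
bookkeeping now has ONE kernel statement whose hypotheses are exactly the lattice-level obligations, on the carrier on which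
b01 PROVED the relative animal leaf and Lemma E.3 — bookkeeping, explicitly LOW–MEDIUM difficulty; NOT summit progress; NOT
continuum; NOT Clay.  Cell records: GAPS.md C-b02g17-1 (v1 p188092), C-b02g17-2 (v1.1 p188173), C-pv15g10-5 (cross-read of
v1/v1.1: 0 objections, REMARK R1, INFO I1/I2), C-b02g18-1 (v1.2); HOME/HANDOFF.md (b02 lineage, gen 17/18).  REVISION v1.2 is ADDITIVE: no
v1.1 declaration changed; the header's DICTIONARY rewritten (R1, I1, I2) and §2′ added.  Naming: `B16Ineq197.Consts` ∕
`B16Ineq197.Polymer` and the instance theorems are written QUALIFIED (cf. `B16Ineq197` header note N1).  Imports the three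
instance modules (`…RelGlue` arrives through `…XBudget`); modifies nothing.
-/

namespace Literature.MathematicalPhysics.QuantumFieldTheory.Balaban1983to89.B16Ineq197Window

open Literature.MathematicalPhysics.QuantumFieldTheory.Balaban1983to89
open Literature.MathematicalPhysics.QuantumFieldTheory.Balaban1983to89.B13ScaleTransfer
open Literature.MathematicalPhysics.QuantumFieldTheory.Balaban1983to89.TreeLength
open Literature.MathematicalPhysics.QuantumFieldTheory.Balaban1983to89.TreeLengthCubeSystem (Cell cellsOf mem_cellsOf
  card_cellsOf)
open Literature.MathematicalPhysics.QuantumFieldTheory.Balaban1983to89.B14.RelTreeLength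
open Literature.MathematicalPhysics.QuantumFieldTheory.Balaban1983to89.B14.RelAnimal (kapparel Krel Krel_pos)
open Literature.MathematicalPhysics.QuantumFieldTheory.Balaban1983to89.B16Ineq197RelGlue (CutLinked cutLinked_of_pairwise
  subadd193_window)

noncomputable section

variable {d : ℕ}

/-! ## §1. The clauses on the constants and the lattice model of one polymer -/

/-- **THE WINDOW CLAUSES on the constants of pp. 388–389** for a window of ℤ^d, a volume bound `V` of the class-1
components and their minimal cube content `n` — the hypotheses on `K : B16Ineq197.Consts` under which the four instance
modules deliver the leaves: junction cost `2 ≤ cJ` (RelGlue; print 2d), cube-count constants `4·2^d ≤ a₁, a₀` (RelCubes, b01's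
leaf constant c₀ = 4·2^d), the "κ large" clause `kapparel(4·2^d, 3^d−1) ≤ ½βκ` and `Krel(4·2^d, 3^d−1) ≤ C₁` of (1.94)
(RelCubes, b01's Lemma E.3 constants), the per-component budget `(1+β)κ(V+1) + lam·βκ·V ≤ E` (XBudget; print E =
2κ(100R_k)^d, V = (100R_k)^d), and the candidate density `n⁻¹ ≤ ρ`, `n ≥ 1` (Count196Packing; print ρ = 100^dR_k^{−d}, n = R_k^d).
Binders, not assertions. [cite: Balaban1989LargeFieldII, pp.388-389] -/
structure Clauses (K : B16Ineq197.Consts) (d : ℕ) (V : ℝ) (n : ℕ) : Prop where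
  two_le_cJ : 2 ≤ K.cJ
  a₁_le : (4 * 2 ^ d : ℝ) ≤ K.a₁
  a₀_le : (4 * 2 ^ d : ℝ) ≤ K.a₀
  kapparel_le : kapparel (4 * 2 ^ d) (3 ^ d - 1) ≤ K.β * K.κ / 2
  krel_le : Krel (4 * 2 ^ d) (3 ^ d - 1) ≤ K.C₁
  budget : (1 + K.β) * K.κ * (V + 1) + K.lam * K.β * K.κ * V ≤ K.E
  n_pos : 0 < n
  inv_le_ρ : ((n : ℝ))⁻¹ ≤ K.ρ

/-- **THE WINDOW CLAUSES AT d = 4 IN THE PRINTED SHAPES OF THE NUMBERS** (consistency only; no optimisation): with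
V = (100R)^4 (an X_j inside a cube of 100R_k cubes of side M, p. 385/389 as read in `B16Ineq197XBudget`), n = R^4 (an X_j
holds ≥ R_k^4 M-cubes, (1.96) as read in `B16Count196Packing`) and ρ = 100^4·R^{−4}, the clauses follow from `2 ≤ cJ`,
`64 ≤ a₁, a₀` (= 4·2⁴), `4215 ≤ ½βκ` (b01's `Window.kapparel_four_lt : kapparel(64, 80) < 4215`), `Krel(64, 80) ≤ C₁`,
`β(1+lam) ≤ ½` and `2κ(100R)^4 ≤ E` (`B16Ineq197XBudget.clause_of_two_mul_le`), given the signs of `Consts.Small`.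
[cite: Balaban1989LargeFieldII, (1.93)-(1.96) pp.388-389] -/
theorem clauses_four_printed (K : B16Ineq197.Consts) (hK : K.Small) (R : ℕ) (hR : 0 < R) (hcJ : 2 ≤ K.cJ)
    (ha₁ : 64 ≤ K.a₁) (ha₀ : 64 ≤ K.a₀) (hκ : 4215 ≤ K.β * K.κ / 2) (hC₁ : Krel (4 * 2 ^ 4) (3 ^ 4 - 1) ≤ K.C₁)
    (hβlam : K.β * (1 + K.lam) ≤ 1 / 2) (hE : 2 * K.κ * ((100 : ℝ) * R) ^ 4 ≤ K.E)
    (hρ : K.ρ = (100 : ℝ) ^ 4 * ((R : ℝ) ^ 4)⁻¹) : Clauses K 4 (((100 : ℝ) * R) ^ 4) (R ^ 4) where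
  two_le_cJ := hcJ
  a₁_le := by
    have h : (4 * 2 ^ 4 : ℝ) = 64 := by norm_num
    rw [h]
    exact ha₁
  a₀_le := by
    have h : (4 * 2 ^ 4 : ℝ) = 64 := by norm_num
    rw [h]
    exact ha₀
  kapparel_le := (Window.kapparel_four_lt).le.trans hκ
  krel_le := hC₁
  budget := by
    have hβ : K.β ≤ 1 / 2 := by nlinarith [mul_nonneg hK.β_nonneg hK.lam_nonneg, hβlam]
    have hR1 : (1 : ℝ) ≤ R := by exact_mod_cast hR
    have h100 : (100 : ℝ) ≤ 100 * R := by linarith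
    have hpow : (100 : ℝ) ^ 4 ≤ (100 * R) ^ 4 := pow_le_pow_left₀ (by norm_num) h100 4
    have hV : 2 + 2 * K.β ≤ ((100 : ℝ) * R) ^ 4 := by
      have h4 : (100 : ℝ) ^ 4 = 100000000 := by norm_num
      linarith
    exact B16Ineq197XBudget.clause_of_two_mul_le hK.β_nonneg hK.κ_nonneg hβlam hV hE
  n_pos := pow_pos hR 4
  inv_le_ρ := by
    rw [hρ, Nat.cast_pow]
    exact B16Count196Packing.inv_pow_le_printed (R : ℝ) (Nat.cast_nonneg R) 4

/-- **THE LATTICE MODEL OF ONE POLYMER X′** of (1.90)–(1.91) on b01's window `W` (large-field set Z′ = `W.Z`), with cube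
family `X' ⊆ W.B`, the cubes `L` of ⋃Y_i, a volume bound `V` and a cube content `n`: the cube families `comp j` of the
class-1 components X_j and EVERY incidence the cell reads into (1.93)–(1.96), as NAMED FIELDS (obligations for the joiner,
pp. 377/385–389; GAPS C-adv6-51, C-adv7-85, S-B16.12/13) — the catalogued Y lie in X′, belong to b01's resummed class and
own a cube outside L ∪ Z′ (anchor); `v = #(X′∖L)`, `dY = d_rel` of W, `treeX j = treeLen (comp j) + 2`, `vol j = #(comp j)`;
the X_j are non-empty face-connected families inside X′∖L, pairwise disjoint, of between n and V cubes; for every admissible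
(S, 𝐃) the cubes of X′∖L are covered by the X_j (j ∈ S) and the small parts Y∖Z′ (Y ∈ 𝐃), and the contact structure on
S ⊔ 𝐃 satisfies RelGlue's cut condition.  Nothing here is asserted. [cite: Balaban1989LargeFieldII, (1.91)-(1.96) pp.388-389] -/
structure Model (W : Window d) {LF : Type*} (P : B16Ineq197.Polymer LF W.relSys.Dom) (X' L : Finset (Pt d)) (V : ℝ)
    (n : ℕ) where
  /-- the cubes of the class-1 component X_j -/
  comp : LF → Finset (Pt d)
  /-- X′ lies in the window -/
  subset_B : X' ⊆ W.B
  /-- the catalogued Y belong to the resummed class of the window -/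
  ycat_adm : P.Ycat ⊆ W.relCubeSys.adm
  /-- the catalogued Y lie in X′ -/
  dom_subset : ∀ Y ∈ P.Ycat, Y.1 ⊆ X'
  /-- every catalogued Y owns a cube outside ⋃Y_i and outside Z′ (an anchor) -/
  anchor : ∀ Y ∈ P.Ycat, ∃ a ∈ Y.1, a ∉ L ∧ a ∉ W.Z
  /-- v = M^{−d}|X′∖⋃Y_i| -/
  v_eq : P.v = ((X' \ L).card : ℝ)
  /-- d(Y) = d_{k,Z′}(Y), the relative size of the window -/
  dY_eq : ∀ Y ∈ P.Ycat, P.dY Y = W.relSys.dRel Y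
  /-- X_j ⊆ X′∖⋃Y_i is a non-empty common-wall connected cube family -/
  comp_spec : ∀ j ∈ P.cand, comp j ⊆ X' \ L ∧ (comp j).Nonempty ∧ FaceConnected (comp j)
  /-- tree cost of X_j = its tree length plus the entry connector -/
  treeX_eq : ∀ j ∈ P.cand, P.treeX j = treeLen (comp j) + 2
  /-- volume of X_j = its cube count -/
  vol_eq : ∀ j ∈ P.cand, P.vol j = ((comp j).card : ℝ)
  /-- the cover behind (1.93) -/
  cover : ∀ p ∈ P.adm, X' \ L ⊆ p.1.biUnion comp ∪ p.2.biUnion (fun Y => Y.1 \ W.Z)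
  /-- the cut condition behind (1.93) -/
  cut : ∀ p ∈ P.adm, CutLinked (p.1.disjSum p.2) (Sum.elim comp (fun Y => Y.1 \ W.Z))
  /-- the X_j are pairwise disjoint -/
  disjoint : (P.cand : Set LF).PairwiseDisjoint comp
  /-- the volume bound of the class-1 components -/
  card_le : ∀ j ∈ P.cand, ((comp j).card : ℝ) ≤ V
  /-- each X_j holds at least n cubes -/
  le_card : ∀ j ∈ P.cand, n ≤ (comp j).card

/-! ## §2. The five leaves from one model -/

namespace Model

variable {W : Window d} {LF : Type*} {P : B16Ineq197.Polymer LF W.relSys.Dom} {X' L : Finset (Pt d)} {V : ℝ} {n : ℕ}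

/-- The components lie in X′. [folklore] -/
theorem comp_subset (M : Model W P X' L V n) {j : LF} (hj : j ∈ P.cand) : M.comp j ⊆ X' :=
  (M.comp_spec j hj).1.trans Finset.sdiff_subset

/-- The components lie in the window. [folklore] -/
theorem comp_subset_B (M : Model W P X' L V n) {j : LF} (hj : j ∈ P.cand) : M.comp j ⊆ W.B :=
  (M.comp_subset hj).trans M.subset_B

/-- **`Subadd193` from the model** (by `B16Ineq197RelGlue.subadd193_window`): the size reading `dX ≤ relTreeLen X′ (X′∖L)`
and the junction clause `2 ≤ cJ` suffice, the Y-graphs existing by b01's `exists_rAdmissible`. [cite: Balaban1989LargeFieldII, (1.93) p.388] -/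
theorem subadd193 (M : Model W P X' L V n) (K : B16Ineq197.Consts) (hdX : P.dX ≤ relTreeLen X' (X' \ L))
    (hcJ : 2 ≤ K.cJ) : P.Subadd193 K :=
  subadd193_window W P K M.comp X' L hdX M.dY_eq (fun j hj => (M.treeX_eq j hj).ge) hcJ
    (fun j hj => ⟨M.comp_subset hj, (M.comp_spec j hj).2.1, (M.comp_spec j hj).2.2⟩) M.dom_subset M.cover M.cut

/-- **`Vol193` from the model** (by `B16Ineq197RelCubes.vol193_window`): U = the cells of X′∖L (#U = v), `Xc j` = the cells
of X_j (#Xc j = vol j), the cover transported to cells, and `4·2^d ≤ a₁, a₀`. [cite: Balaban1989LargeFieldII, (1.93) p.388] -/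
theorem vol193 (M : Model W P X' L V n) (K : B16Ineq197.Consts) (ha₁ : (4 * 2 ^ d : ℝ) ≤ K.a₁)
    (ha₀ : (4 * 2 ^ d : ℝ) ≤ K.a₀) : P.Vol193 K :=
  B16Ineq197RelCubes.vol193_window W P K M.dY_eq (cellsOf W.B (X' \ L))
    (le_of_eq (by rw [M.v_eq, card_cellsOf (Finset.sdiff_subset.trans M.subset_B)]))
    (fun j => cellsOf W.B (M.comp j))
    (fun j hj => le_of_eq (by rw [M.vol_eq j hj, card_cellsOf (M.comp_subset_B hj)]))
    (fun p hp c hc => by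
      rcases Finset.mem_union.1 (M.cover p hp (mem_cellsOf.1 hc)) with h | h
      · obtain ⟨j, hj, hcj⟩ := Finset.mem_biUnion.1 h
        exact Or.inr ⟨j, hj, mem_cellsOf.2 hcj⟩
      · obtain ⟨Y, hY, hcY⟩ := Finset.mem_biUnion.1 h
        exact Or.inl ⟨Y, hY, (Finset.mem_sdiff.1 hcY).1, (Finset.mem_sdiff.1 hcY).2⟩)
    ha₁ ha₀

/-- **`XBudget` from the model** (by `B16Ineq197XBudget.xBudget_of_treeLen`): `treeX j = treeLen (comp j) + 2 ≤ #(comp j) + 1`,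
`vol j = #(comp j) ≤ V`, the signs of `Consts.Small` and the budget clause. [cite: Balaban1989LargeFieldII, p.389] -/
theorem xBudget (M : Model W P X' L V n) (K : B16Ineq197.Consts) (hK : K.Small)
    (hE : (1 + K.β) * K.κ * (V + 1) + K.lam * K.β * K.κ * V ≤ K.E) : P.XBudget K :=
  B16Ineq197XBudget.xBudget_of_treeLen P K M.comp V (fun j hj => (M.comp_spec j hj).2)
    (fun j hj => (M.treeX_eq j hj).le) (fun j hj => (M.vol_eq j hj).le) M.card_le
    hK.β_nonneg hK.κ_nonneg hK.lam_nonneg hE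

/-- **`Anch194` from the model** (by `B16Ineq197RelCubes.anch194_window`): the anchors are the cells of (X′∖L)∖Z′ (at most
v of them, every catalogued Y holds one by `anchor`), `α ≥ 0` from `Consts.Small`, and the two (1.94) clauses.
[cite: Balaban1989LargeFieldII, (1.94) p.389] -/
theorem anch194 (M : Model W P X' L V n) (K : B16Ineq197.Consts) (hK : K.Small)
    (hκ : kapparel (4 * 2 ^ d) (3 ^ d - 1) ≤ K.β * K.κ / 2) (hC₁ : Krel (4 * 2 ^ d) (3 ^ d - 1) ≤ K.C₁) :
    P.Anch194 K :=
  B16Ineq197RelCubes.anch194_window W P K hK.α_pos.le M.ycat_adm M.dY_eq (cellsOf W.B ((X' \ L) \ W.Z))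
    (fun c hc => (Finset.mem_sdiff.1 (mem_cellsOf.1 hc)).2)
    (by
      rw [M.v_eq, card_cellsOf ((Finset.sdiff_subset.trans Finset.sdiff_subset).trans M.subset_B)]
      exact_mod_cast (Finset.card_le_card Finset.sdiff_subset : ((X' \ L) \ W.Z).card ≤ (X' \ L).card))
    (fun Y hY => by
      obtain ⟨a, haY, haL, haZ⟩ := M.anchor Y hY
      exact ⟨⟨a, M.subset_B (M.dom_subset Y hY haY)⟩,
        mem_cellsOf.2 (Finset.mem_sdiff.2 ⟨Finset.mem_sdiff.2 ⟨M.dom_subset Y hY haY, haL⟩, haZ⟩), haY⟩)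
    hκ hC₁

/-- **`Count196` from the model** (by `B16Count196Packing.count196_of_packing` with the cube type `Pt d`): the X_j are
pairwise disjoint subsets of X′∖L of ≥ n cubes, `#(X′∖L) = v`, and `n⁻¹ ≤ ρ`. [cite: Balaban1989LargeFieldII, (1.96) p.389] -/
theorem count196 (M : Model W P X' L V n) (K : B16Ineq197.Consts) (hn : 0 < n) (hρ : ((n : ℝ))⁻¹ ≤ K.ρ) :
    P.Count196 K :=
  B16Count196Packing.count196_of_packing P K (X' \ L) M.comp n hn M.disjoint (fun j hj => (M.comp_spec j hj).1)
    M.le_card M.v_eq.ge hρ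

/-- **ALL FIVE LATTICE LEAVES OF `B16Ineq197` FROM ONE MODEL**: a lattice model of the polymer on the window, the clauses
`Clauses K d V n`, the signs of `Consts.Small`, and the size reading `dX ≤ relTreeLen X′ (X′∖L)` give `Subadd193 ∧ Vol193 ∧
XBudget ∧ Anch194 ∧ Count196`. [cite: Balaban1989LargeFieldII, (1.93)-(1.96) pp.388-389] -/
theorem leaves (M : Model W P X' L V n) (K : B16Ineq197.Consts) (hK : K.Small) (hC : Clauses K d V n)
    (hdX : P.dX ≤ relTreeLen X' (X' \ L)) :
    P.Subadd193 K ∧ P.Vol193 K ∧ P.XBudget K ∧ P.Anch194 K ∧ P.Count196 K :=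
  ⟨M.subadd193 K hdX hC.two_le_cJ, M.vol193 K hC.a₁_le hC.a₀_le, M.xBudget K hK hC.budget,
    M.anch194 K hK hC.kapparel_le hC.krel_le, M.count196 K hC.n_pos hC.inv_le_ρ⟩

end Model

/-! ## §2′. One window set for every term (v1.2; cross-read REMARK R1)

Print's Z′ = ⋃_{i=1}^m Y_i ∪ ⋃_{h=1}^q X_{j_h} (p. 388) depends on the term (S, 𝐃) of (1.91); the model fixes one `W.Z`.
The lemmas of this section show, over TERM-SHAPED BINDERS (nothing printed is asserted), that under the cell's certified
reading GAPS C-adv7-85 (a) the two agree on everything the leaves consume: with Z = `W.Z` ⊇ the classified large-field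
cubes, Z ∩ X′ ⊆ ⋃Y_i ∪ ⋃_{j∈S} X_j, hence Y ∩ Z′ = Y ∩ Z for the catalogued Y ⊂ X′ (so d_{k,Z′}(Y) = `W.relSys.dRel Y`
and Y∖Z′ = Y∖Z), and the model's `cover` and `anchor` fields follow.  Generic finite-set statements first, then the
window versions in which the gluing binder (a catalogued Y contains every class-1 component it meets) is a THEOREM of
b01's resummed class
(`Window.IsAdm`, the closure clause of p. 262 [III]). -/

/-- Equal traces give equal complements: `Y ∩ Z₁ = Y ∩ Z₂ → Y∖Z₁ = Y∖Z₂`. [folklore] -/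
theorem sdiff_eq_sdiff_of_inter_eq {α : Type*} [DecidableEq α] {Y Z₁ Z₂ : Finset α} (h : Y ∩ Z₁ = Y ∩ Z₂) :
    Y \ Z₁ = Y \ Z₂ := by
  ext c
  have key := Finset.ext_iff.1 h c
  simp only [Finset.mem_inter, Finset.mem_sdiff] at key ⊢
  constructor
  · rintro ⟨hcY, hc⟩
    exact ⟨hcY, fun hc₂ => hc (key.2 ⟨hcY, hc₂⟩).2⟩
  · rintro ⟨hcY, hc⟩
    exact ⟨hcY, fun hc₁ => hc (key.1 ⟨hcY, hc₁⟩).2⟩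

/-- **d_{k,Z′}(Y) = d_{k,Z}(Y) when Z′ and Z have the same trace on Y**: the relative size (1.67) of a domain Y of the
window with respect to ANY cube family Z′ with `Y ∩ Z′ = Y ∩ W.Z` is the window's `dRel Y` — the term-dependence of
print's Z′ is invisible to the rate of `Major192` once Y ∩ Z′ = Y ∩ Z (`inter_zprime_eq`). [cite: Balaban1989LargeFieldII, (1.67) p.376, (1.92) p.388] -/
theorem dRel_eq_of_inter_eq (W : Window d) (Y : W.relSys.Dom) {Z' : Finset (Pt d)} (h : Y.1 ∩ Z' = Y.1 ∩ W.Z) :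
    relTreeLen Y.1 (Y.1 \ Z') = W.relSys.dRel Y := by
  rw [Window.relSys_dRel, sdiff_eq_sdiff_of_inter_eq h]

/-- **A domain of b01's resummed class contains every class-1 component it meets**: if `Y` satisfies `Window.IsAdm`
(the closure form of the p. 262 [III] dichotomy for the resummed (2.41), quoted in the docstring of b01's `Window.IsAdm`),
`C ⊆ W.Z` is common-wall connected and `Y ∩ C ≠ ∅`, then `C ⊆ Y` (induction along a chain of
C, each step a corner-adjacent pair of Z-cubes).  This is the window form of the p. 377 property of the catalogued Y used
in cell GAPS C-adv7-85 (a). [cite: Balaban1988Convergent, p.262 ll.6-15] -/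
theorem subset_of_isAdm_of_meets (W : Window d) {Y C : Finset (Pt d)} (hY : W.IsAdm Y) (hC : C ⊆ W.Z)
    (hCc : FaceConnected C) (h : (Y ∩ C).Nonempty) : C ⊆ Y := by
  obtain ⟨a, ha⟩ := h
  have haY : a ∈ Y := (Finset.mem_inter.1 ha).1
  have haC : a ∈ C := (Finset.mem_inter.1 ha).2
  intro b hb
  have hlink : Linked C a b := hCc a haC b hb
  clear hb
  unfold Linked at hlink
  induction hlink with
  | refl => exact haY
  | @tail x y _ hxy ih => exact hY.1 x ih (hC hxy.1) y (hC hxy.2.1) (cadj_of_adj hxy.2.2)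

/-- **Z ∩ X′ ⊆ ⋃Y_i ∪ ⋃_{j∈S} X_j FROM TERM-SHAPED BINDERS** (cell GAPS C-adv7-85 (a) as a finite-set lemma): if the
large-field cubes of X′ are class-2 cubes (`L`) or cubes of classified class-1 components (`comp j`, `j ∈ J`; p. 378), the
pair (S, 𝐃) determines X′ (`X′ ⊆ ⋃_{j∈S} X_j ∪ ⋃_{Y∈𝐃} Y`, (1.91)) with every Y ⊂ X′, every Y ∈ 𝐃 contains each
class-1 component it meets (p. 377), and every non-empty class-1 component inside X′ is selected (p. 387: all n factors
𝐓′_k(X_j) of (1.72) occur in every Mayer term), then every large-field cube of X′ lies in `L` or in a SELECTED component —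
i.e. Z ∩ X′ ⊂ Z′ for this term.  Binders, not assertions. [cite: Balaban1989LargeFieldII, (1.91)-(1.92) p.388, p.387] -/
theorem largeField_inter_subset {ι σ : Type*} (J S : Finset ι) (comp : ι → Finset (Pt d)) (D : Finset σ)
    (dom : σ → Finset (Pt d)) (Z L X' : Finset (Pt d)) (hZ : Z ∩ X' ⊆ L ∪ J.biUnion comp)
    (hX : X' ⊆ S.biUnion comp ∪ D.biUnion dom) (hDX : ∀ Y ∈ D, dom Y ⊆ X')
    (hglue : ∀ Y ∈ D, ∀ j ∈ J, (dom Y ∩ comp j).Nonempty → comp j ⊆ dom Y)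
    (hall : ∀ j ∈ J, (comp j).Nonempty → comp j ⊆ X' → j ∈ S) : Z ∩ X' ⊆ L ∪ S.biUnion comp := by
  intro c hc
  have hcX : c ∈ X' := (Finset.mem_inter.1 hc).2
  rcases Finset.mem_union.1 (hZ hc) with hcL | hcJ
  · exact Finset.mem_union_left _ hcL
  · obtain ⟨j, hj, hcj⟩ := Finset.mem_biUnion.1 hcJ
    rcases Finset.mem_union.1 (hX hcX) with hcS | hcD
    · exact Finset.mem_union_right _ hcS
    · obtain ⟨Y, hY, hcY⟩ := Finset.mem_biUnion.1 hcD
      have hsub : comp j ⊆ X' :=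
        (hglue Y hY j hj ⟨c, Finset.mem_inter.2 ⟨hcY, hcj⟩⟩).trans (hDX Y hY)
      exact Finset.mem_union_right _ (Finset.mem_biUnion.2 ⟨j, hall j hj ⟨c, hcj⟩ hsub, hcj⟩)

/-- **Y ∩ Z′ = Y ∩ Z for the catalogued Y ⊂ X′**: if Z ∩ X′ ⊆ L ∪ ⋃_{j∈S} X_j (`largeField_inter_subset`) and the
pieces of Z′ = L ∪ ⋃_{j∈S} X_j are large-field cubes (Z′ ⊂ Z, p. 378), then a cube family Y ⊆ X′ has the same trace on
Z′ and on Z — so d_{k,Z′}(Y) = d_{k,Z}(Y) (`dRel_eq_of_inter_eq`) and Y∖Z′ = Y∖Z (`sdiff_eq_sdiff_of_inter_eq`).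
[cite: Balaban1989LargeFieldII, (1.92) p.388] -/
theorem inter_zprime_eq {ι : Type*} (S : Finset ι) (comp : ι → Finset (Pt d)) (Z L X' Y : Finset (Pt d))
    (hZX : Z ∩ X' ⊆ L ∪ S.biUnion comp) (hLZ : L ⊆ Z) (hSZ : ∀ j ∈ S, comp j ⊆ Z) (hY : Y ⊆ X') :
    Y ∩ (L ∪ S.biUnion comp) = Y ∩ Z := by
  ext c
  simp only [Finset.mem_inter]
  constructor
  · rintro ⟨hcY, hc⟩
    refine ⟨hcY, ?_⟩
    rcases Finset.mem_union.1 hc with hcL | hcS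
    · exact hLZ hcL
    · obtain ⟨j, hj, hcj⟩ := Finset.mem_biUnion.1 hcS
      exact hSZ j hj hcj
  · rintro ⟨hcY, hcZ⟩
    exact ⟨hcY, hZX (Finset.mem_inter.2 ⟨hcZ, hY hcY⟩)⟩

/-- **THE MODEL'S `cover` FIELD FROM TERM-SHAPED BINDERS**: if every admissible pair determines X′ (`X′ ⊆ ⋃_{j∈S} X_j ∪
⋃_{Y∈𝐃} Y`) and every large-field cube of X′ is a cube of ⋃Y_i or of a selected component (Z ∩ X′ ⊆ L ∪ ⋃_{j∈S} X_j,
`largeField_inter_subset`), then the small cubes X′∖L are covered by the selected components and the small parts `Y∖W.Z`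
of the 𝐃-members — the field `Model.cover` with the SINGLE window set `W.Z`. [cite: Balaban1989LargeFieldII, (1.93) p.388] -/
theorem cover_of_term (W : Window d) {LF : Type*} (P : B16Ineq197.Polymer LF W.relSys.Dom) (comp : LF → Finset (Pt d))
    (X' L : Finset (Pt d)) (hX : ∀ p ∈ P.adm, X' ⊆ p.1.biUnion comp ∪ p.2.biUnion (fun Y => Y.1))
    (hZX : ∀ p ∈ P.adm, W.Z ∩ X' ⊆ L ∪ p.1.biUnion comp) :
    ∀ p ∈ P.adm, X' \ L ⊆ p.1.biUnion comp ∪ p.2.biUnion (fun Y => Y.1 \ W.Z) := by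
  intro p hp c hc
  have hcX : c ∈ X' := (Finset.mem_sdiff.1 hc).1
  have hcL : c ∉ L := (Finset.mem_sdiff.1 hc).2
  rcases Finset.mem_union.1 (hX p hp hcX) with hcS | hcD
  · exact Finset.mem_union_left _ hcS
  · obtain ⟨Y, hY, hcY⟩ := Finset.mem_biUnion.1 hcD
    by_cases hcZ : c ∈ W.Z
    · rcases Finset.mem_union.1 (hZX p hp (Finset.mem_inter.2 ⟨hcZ, hcX⟩)) with hl | hr
      · exact absurd hl hcL
      · exact Finset.mem_union_left _ hr
    · exact Finset.mem_union_right _ (Finset.mem_biUnion.2 ⟨Y, hY, Finset.mem_sdiff.2 ⟨hcY, hcZ⟩⟩)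

/-- **THE MODEL'S `anchor` FIELD FROM Y∖Z~ ≠ ∅**: if every catalogued Y owns a cube outside an enlarged set `Zt` ⊇ L ∪ W.Z
(print: the catalogued Y have Y∖Z~ ≠ ∅, p. 377, and ⋃Y_i ∪ Z′ ⊆ Z ⊆ Z~), that cube is an anchor outside ⋃Y_i and outside
the window's large field. [cite: Balaban1989LargeFieldII, (1.68) p.377, (1.94) p.389] -/
theorem anchor_of_sdiff_nonempty (W : Window d) {LF : Type*} (P : B16Ineq197.Polymer LF W.relSys.Dom)
    (L Zt : Finset (Pt d)) (hL : L ⊆ Zt) (hZ : W.Z ⊆ Zt) (hY : ∀ Y ∈ P.Ycat, (Y.1 \ Zt).Nonempty) :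
    ∀ Y ∈ P.Ycat, ∃ a ∈ Y.1, a ∉ L ∧ a ∉ W.Z := by
  intro Y hYc
  obtain ⟨a, ha⟩ := hY Y hYc
  exact ⟨a, (Finset.mem_sdiff.1 ha).1, fun haL => (Finset.mem_sdiff.1 ha).2 (hL haL),
    fun haZ => (Finset.mem_sdiff.1 ha).2 (hZ haZ)⟩

/-- **Z ∩ X′ ⊆ ⋃Y_i ∪ ⋃_{j∈S} X_j ON THE WINDOW**, the gluing binder of `largeField_inter_subset` DISCHARGED by b01's
class: for catalogued Y in `W.admSet` (the model's field `ycat_adm`) and classified class-1 components that are common-wall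
connected families of Z-cubes, `subset_of_isAdm_of_meets` supplies the gluing binder; the remaining binders are the
classification of the large-field cubes of X′, the determination of X′ by the pair, Y ⊂ X′ for Y ∈ 𝐃, and the selection
of every non-empty class-1 component inside X′. [cite: Balaban1989LargeFieldII, (1.91)-(1.92) p.388, p.387] -/
theorem largeField_inter_subset_window (W : Window d) {ι : Type*} (J S : Finset ι) (comp : ι → Finset (Pt d))
    (D : Finset W.relSys.Dom) (L X' : Finset (Pt d)) (hZ : W.Z ∩ X' ⊆ L ∪ J.biUnion comp)
    (hclZ : ∀ j ∈ J, comp j ⊆ W.Z) (hclc : ∀ j ∈ J, FaceConnected (comp j))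
    (hX : X' ⊆ S.biUnion comp ∪ D.biUnion (fun Y => Y.1)) (hDX : ∀ Y ∈ D, Y.1 ⊆ X')
    (hadm : ∀ Y ∈ D, Y ∈ W.admSet) (hall : ∀ j ∈ J, (comp j).Nonempty → comp j ⊆ X' → j ∈ S) :
    W.Z ∩ X' ⊆ L ∪ S.biUnion comp :=
  largeField_inter_subset J S comp D (fun Y => Y.1) W.Z L X' hZ hX hDX
    (fun Y hY j hj hm => subset_of_isAdm_of_meets W (W.mem_admSet.1 (hadm Y hY)) (hclZ j hj) (hclc j hj) hm) hall

/-- **d_{k,Z′}(Y) = `dY Y` FOR EVERY TERM AND EVERY Y OF THE TERM** (the headline of this section): if every large-field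
cube of X′ is a cube of ⋃Y_i or of a selected component of the pair (`largeField_inter_subset`), ⋃Y_i ⊆ Z, the
candidate components are families of Z-cubes and the catalogued Y lie in X′, then for every admissible pair (S, 𝐃) and
every Y ∈ 𝐃 the relative size of Y with respect to THIS TERM's Z′ = L ∪ ⋃_{j∈S} X_j is the window's `dRel Y` — the one
value the model's `dY_eq` prescribes; so `Major192` at rate `W.relSys.dRel` asks no more than print's per-term rate
d_{k,Z′}(Y) of (1.92). [cite: Balaban1989LargeFieldII, (1.92) p.388] -/
theorem dRel_term_eq (W : Window d) {LF : Type*} (P : B16Ineq197.Polymer LF W.relSys.Dom) (comp : LF → Finset (Pt d))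
    (X' L : Finset (Pt d)) (hZX : ∀ p ∈ P.adm, W.Z ∩ X' ⊆ L ∪ p.1.biUnion comp) (hLZ : L ⊆ W.Z)
    (hSZ : ∀ j ∈ P.cand, comp j ⊆ W.Z) (hDX : ∀ Y ∈ P.Ycat, Y.1 ⊆ X') :
    ∀ p ∈ P.adm, ∀ Y ∈ p.2, relTreeLen Y.1 (Y.1 \ (L ∪ p.1.biUnion comp)) = W.relSys.dRel Y :=
  fun p hp Y hY =>
    dRel_eq_of_inter_eq W Y
      (inter_zprime_eq p.1 comp W.Z L X' Y.1 (hZX p hp) hLZ (fun j hj => hSZ j (P.adm_fst p hp hj))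
        (hDX Y (P.adm_snd p hp hY)))

/-! ## §3. The edge to `B16.Ineq197` on a window's relative domain system -/

/-- **(1.92)–(1.96) ⇒ (1.97) ON THE LATTICE CARRIER.**  Two windows on the cube lattice ℤ^d: `W` carries the large-field set
Z′ (relative sizes of the Y, anchors), `WL` carries ⋃Y_i (`WL.relSys.dRel X′ = relTreeLen X′ (X′∖⋃Y_i) = d_{k,∪Y_i}(X′)`,
`WL.relSys.MeetsLF X′` = "X′ meets ⋃Y_i", the c₁-selector); `WL = W` is allowed.  If every polymer X′ (a domain of WL) has
a lattice model on W with L = the cubes of ⋃Y_i, its size is read as `dX = d_{k,∪Y_i}(X′)`, the activities are the resummed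
sums (1.91) of terms obeying the majorant (1.92) (`Major192`, a binder), the constants satisfy `Consts.Small` and
`Clauses K d V n`, and the two selector facts of p. 389 hold (cell C-adv7-86; binders), then unit b02's quoted leaf
`B16.Ineq197` holds for these activities on `WL.relSys` with `c₁ = exp(−p₀(g_k))` resp. `α^{1/3}` — by `Model.leaves` and
`B16Ineq197.ineq197_of_leaves`. [cite: Balaban1989LargeFieldII, (1.92)-(1.97) pp.388-390] -/
theorem ineq197_window (WL W : Window d) {LF Φ : Type*} (dom : WL.relSys.Dom → Set Φ)
    (P : WL.relSys.Dom → B16Ineq197.Polymer LF W.relSys.Dom) (K : B16Ineq197.Consts) (hK : K.Small) {V : ℝ} {n : ℕ}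
    (hC : Clauses K d V n) (M : ∀ X, Model W (P X) X.1 WL.Z V n) (hdX : ∀ X, (P X).dX = WL.relSys.dRel X)
    (term : WL.relSys.Dom → Finset LF × Finset W.relSys.Dom → Φ → ℂ) (F : WL.relSys.Dom → Φ → ℂ)
    (hF : ∀ X, ∀ φ ∈ dom X, F X φ = ∑ p ∈ (P X).adm, term X p φ)
    (h192 : ∀ X, ∀ φ ∈ dom X, (P X).Major192 K (fun p => term X p φ))
    (selA : ∀ X, WL.relSys.MeetsLF X → ∀ p ∈ (P X).adm, p.2.Nonempty)
    (selB : ∀ X, ¬ WL.relSys.MeetsLF X → ∀ p ∈ (P X).adm, p.1.Nonempty) :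
    B16.Ineq197 WL.relSys dom F K.p0 K.α K.β K.κ := by
  classical
  have hL : ∀ X, (P X).Subadd193 K ∧ (P X).Vol193 K ∧ (P X).XBudget K ∧ (P X).Anch194 K ∧ (P X).Count196 K :=
    fun X => (M X).leaves K hK hC (le_of_eq (by rw [hdX X, Window.relSys_dRel]))
  exact B16Ineq197.ineq197_of_leaves WL.relSys dom P K hK term F hF hdX h192 (fun X => (hL X).1)
    (fun X => (hL X).2.1) (fun X => (hL X).2.2.1) (fun X => (hL X).2.2.2.1) (fun X => (hL X).2.2.2.2) selA selB

/-! ## §4. Non-vacuity: a two-cube window of ℤ¹ on which model, clauses and `Consts.Small` hold at once -/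

namespace Toy

/-- The two cubes 0 and 1 of ℤ¹ (`B16Ineq197RelGlue.Toy.tpt`). [folklore] -/
def B₂ : Finset (Pt 1) := {B16Ineq197RelGlue.Toy.tpt false, B16Ineq197RelGlue.Toy.tpt true}

/-- `#B₂ ≤ 2`. [folklore] -/
theorem card_B₂_le : B₂.card ≤ 2 := Finset.card_le_two

/-- THE TOY WINDOW: B = Ω_j = Λ_j = both cubes, Λ_j^0 = ∅ (the layer property is vacuous); hence Z_j = ∅. [folklore] -/
def toyW : Window 1 where
  B := B₂
  Omega := B₂
  Lam := B₂
  Lam0 := ∅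
  omega_subset := subset_rfl
  lam_subset_omega := subset_rfl
  lam0_subset_lam := Finset.empty_subset _
  layer := fun a ha => absurd ha (Finset.notMem_empty a)

/-- The toy window has no large-field cubes. [folklore] -/
theorem toyW_Z : toyW.Z = ∅ := Finset.sdiff_self B₂

/-- The toy κ: at least 64, at least twice b01's threshold `kapparel(4·2¹, 3¹−1)`, at least 64 times b01's constant
`Krel(4·2¹, 3¹−1)`. [folklore] -/
def κ₁ : ℝ := max 64 (max (2 * kapparel (4 * 2 ^ 1) (3 ^ 1 - 1)) (64 * Krel (4 * 2 ^ 1) (3 ^ 1 - 1)))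

/-- `64 ≤ κ₁`. [folklore] -/
theorem le_κ₁ : (64 : ℝ) ≤ κ₁ := le_max_left _ _

/-- `2·kapparel ≤ κ₁`. [folklore] -/
theorem kapparel_le_κ₁ : 2 * kapparel (4 * 2 ^ 1) (3 ^ 1 - 1) ≤ κ₁ :=
  (le_max_left _ _).trans (le_max_right _ _)

/-- `64·Krel ≤ κ₁`. [folklore] -/
theorem krel_le_κ₁ : 64 * Krel (4 * 2 ^ 1) (3 ^ 1 - 1) ≤ κ₁ :=
  (le_max_right _ _).trans (le_max_right _ _)

/-- THE TOY CONSTANTS: β = 1, κ = κ₁, lam = 1/16, a₁ = a₀ = 8, cJ = 2, C₁ = Krel(8, 2), E = (6 + ⅛)κ₁ (the budget clause with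
V = 2, with equality), p₀ = 2E, β₀ = s = 0, ρ = 1, α = exp(−3·(9/2)κ₁) (so that α^{1/3} = exp(−((1+β)κcJ + lam·βκ·a₀))).
[folklore] -/
def toyK : B16Ineq197.Consts where
  α := Real.exp (-3 * (9 / 2 * κ₁))
  β := 1
  κ := κ₁
  p0 := 2 * (6 * κ₁ + κ₁ / 8)
  β₀ := 0
  s := 0
  E := 6 * κ₁ + κ₁ / 8
  lam := 1 / 16
  a₁ := 8
  a₀ := 8
  cJ := 2
  C₁ := Krel (4 * 2 ^ 1) (3 ^ 1 - 1)
  ρ := 1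

/-- `α^{1/3} = exp(−(9/2)κ₁)`. [folklore] -/
theorem toyK_rpow : toyK.α ^ (1 / 3 : ℝ) = Real.exp (-(9 / 2 * κ₁)) := by
  show Real.exp (-3 * (9 / 2 * κ₁)) ^ (1 / 3 : ℝ) = Real.exp (-(9 / 2 * κ₁))
  rw [← Real.exp_mul]
  congr 1
  ring

/-- **The toy constants satisfy every clause of `Consts.Small`** (junction with equality; the cancellations from
`64·Krel ≤ κ₁` and `64 ≤ κ₁`; the budget −2p₀ + 0 + E = −(3/2)p₀ for p₀ = 2E). [folklore] -/
theorem toy_small : toyK.Small where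
  α_pos := Real.exp_pos _
  α_le_one := Real.exp_le_one_iff.2 (by linarith [le_κ₁])
  β_nonneg := by norm_num [toyK]
  κ_nonneg := by show (0 : ℝ) ≤ κ₁; linarith [le_κ₁]
  lam_nonneg := by norm_num [toyK]
  p0_nonneg := by show (0 : ℝ) ≤ 2 * (6 * κ₁ + κ₁ / 8); linarith [le_κ₁]
  C₁_nonneg := (Krel_pos _ _).le
  junction := by
    have h : (1 + toyK.β) * toyK.κ * toyK.cJ + toyK.lam * toyK.β * toyK.κ * toyK.a₀ = 9 / 2 * κ₁ := by
      show (1 + 1) * κ₁ * 2 + 1 / 16 * 1 * κ₁ * 8 = 9 / 2 * κ₁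
      ring
    rw [toyK_rpow, h, ← Real.exp_add, neg_add_cancel, Real.exp_zero]
  slope := by norm_num [toyK]
  budget := by
    show -(2 * (1 + (0 : ℝ))⁻¹ * (2 * (6 * κ₁ + κ₁ / 8))) + 0 + (6 * κ₁ + κ₁ / 8) ≤ -(3 / 2) * (2 * (6 * κ₁ + κ₁ / 8))
    have h1 : (1 + (0 : ℝ))⁻¹ = 1 := by norm_num
    rw [h1]
    linarith
  cancel_κ := by
    rw [toyK_rpow]
    show 2 * Krel (4 * 2 ^ 1) (3 ^ 1 - 1) * Real.exp (-(9 / 2 * κ₁)) ≤ 1 / 16 * 1 * κ₁ / 2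
    have hK0 : 0 ≤ 2 * Krel (4 * 2 ^ 1) (3 ^ 1 - 1) := mul_nonneg (by norm_num) (Krel_pos _ _).le
    have he : Real.exp (-(9 / 2 * κ₁)) ≤ 1 := Real.exp_le_one_iff.2 (by linarith [le_κ₁])
    have h64 : 2 * Krel (4 * 2 ^ 1) (3 ^ 1 - 1) * 32 ≤ κ₁ :=
      calc 2 * Krel (4 * 2 ^ 1) (3 ^ 1 - 1) * 32 = 64 * Krel (4 * 2 ^ 1) (3 ^ 1 - 1) := by ring
        _ ≤ κ₁ := krel_le_κ₁
    calc 2 * Krel (4 * 2 ^ 1) (3 ^ 1 - 1) * Real.exp (-(9 / 2 * κ₁))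
        ≤ 2 * Krel (4 * 2 ^ 1) (3 ^ 1 - 1) * 1 := mul_le_mul_of_nonneg_left he hK0
      _ = 2 * Krel (4 * 2 ^ 1) (3 ^ 1 - 1) * 32 / 32 := by ring
      _ ≤ κ₁ / 32 := div_le_div_of_nonneg_right h64 (by norm_num)
      _ = 1 / 16 * 1 * κ₁ / 2 := by ring
  cancel_g := by
    show Real.exp (-(2 * (6 * κ₁ + κ₁ / 8) / 2)) * 1 ≤ 1 / 16 * 1 * κ₁ / 2
    rw [mul_one]
    have he : Real.exp (-(2 * (6 * κ₁ + κ₁ / 8) / 2)) ≤ 1 := Real.exp_le_one_iff.2 (by linarith [le_κ₁])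
    have h2 : (1 : ℝ) ≤ 1 / 16 * 1 * κ₁ / 2 := by linarith [le_κ₁]
    exact he.trans h2

/-- **The toy constants satisfy the window clauses** for d = 1, V = 2, n = 1 (b01's genuine `kapparel`, `Krel` at
(c₀, Δ) = (4·2¹, 3¹−1)). [folklore] -/
theorem toy_clauses : Clauses toyK 1 2 1 where
  two_le_cJ := by norm_num [toyK]
  a₁_le := by norm_num [toyK]
  a₀_le := by norm_num [toyK]
  kapparel_le := by
    show kapparel (4 * 2 ^ 1) (3 ^ 1 - 1) ≤ 1 * κ₁ / 2
    rw [one_mul, le_div_iff₀' (by norm_num : (0 : ℝ) < 2)]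
    exact kapparel_le_κ₁
  krel_le := le_rfl
  budget := by
    show (1 + 1) * κ₁ * (2 + 1) + 1 / 16 * 1 * κ₁ * 2 ≤ 6 * κ₁ + κ₁ / 8
    linarith
  n_pos := Nat.one_pos
  inv_le_ρ := by norm_num [toyK]

/-- THE TOY POLYMER of a domain X of the toy window: one class-1 component (index `()`) which is X itself, no catalogued Y,
one admissible pair ({()}, ∅); sizes dX = d_rel(X), v = vol = #X, treeX = treeLen X + 2. [folklore] -/
def toyP (X : toyW.relSys.Dom) : B16Ineq197.Polymer Unit toyW.relSys.Dom where
  cand := Finset.univ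
  Ycat := ∅
  adm := {(Finset.univ, ∅)}
  dX := toyW.relSys.dRel X
  v := (X.1.card : ℝ)
  dY := fun _ => 0
  treeX := fun _ => treeLen X.1 + 2
  vol := fun _ => (X.1.card : ℝ)
  adm_fst := fun _ _ => Finset.subset_univ _
  adm_snd := fun p hp => by rw [Finset.mem_singleton.1 hp]
  v_nonneg := Nat.cast_nonneg _
  dY_nonneg := fun _ _ => le_rfl

/-- **The lattice model of the toy polymer** (V = 2, n = 1): the component is X (⊆ X∖∅, non-empty, face-connected, 1 ≤ #X ≤
#B = 2), the cover is X ⊆ X, the cut condition is vacuous on a one-member family, no Y. [folklore] -/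
def toyM (X : toyW.relSys.Dom) : Model toyW (toyP X) X.1 toyW.Z 2 1 where
  comp := fun _ => X.1
  subset_B := X.2.1
  ycat_adm := fun Y hY => absurd hY (Finset.notMem_empty Y)
  dom_subset := fun Y hY => absurd hY (Finset.notMem_empty Y)
  anchor := fun Y hY => absurd hY (Finset.notMem_empty Y)
  v_eq := by
    show (X.1.card : ℝ) = ((X.1 \ toyW.Z).card : ℝ)
    rw [toyW_Z, Finset.sdiff_empty]
  dY_eq := fun Y hY => absurd hY (Finset.notMem_empty Y)
  comp_spec := fun _ _ =>
    ⟨fun c hc => Finset.mem_sdiff.2 ⟨hc, by rw [toyW_Z]; exact Finset.notMem_empty c⟩, X.2.2.1, X.2.2.2⟩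
  treeX_eq := fun _ _ => rfl
  vol_eq := fun _ _ => rfl
  cover := fun p hp c hc => by
    rw [Finset.mem_singleton.1 hp]
    exact Finset.mem_union_left _ (Finset.mem_biUnion.2 ⟨(), Finset.mem_univ _, (Finset.mem_sdiff.1 hc).1⟩)
  cut := fun p hp => by
    rw [Finset.mem_singleton.1 hp]
    refine cutLinked_of_pairwise fun i hi j hj hij => ?_
    rcases i with u | Y
    · rcases j with u' | Y'
      · exact absurd (congrArg Sum.inl (Subsingleton.elim u u')) hij
      · exact absurd (Finset.inr_mem_disjSum.1 hj) (Finset.notMem_empty Y')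
    · exact absurd (Finset.inr_mem_disjSum.1 hi) (Finset.notMem_empty Y)
  disjoint := fun a _ b _ hab => absurd (Subsingleton.elim a b) hab
  card_le := fun _ _ => by
    have h : X.1.card ≤ 2 := (Finset.card_le_card X.2.1).trans card_B₂_le
    exact_mod_cast h
  le_card := fun _ _ => Finset.one_le_card.2 X.2.2.1

/-- The toy term: the (1.92) majorant `θ^{#S}` itself (𝐃 = ∅), a nonzero number. [folklore] -/
def toyTerm (_X : toyW.relSys.Dom) (p : Finset Unit × Finset toyW.relSys.Dom) (_φ : Unit) : ℂ :=
  ((toyK.θ ^ p.1.card : ℝ) : ℂ)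

/-- The toy term obeys (1.92) (with equality). [folklore] -/
theorem toy_major (X : toyW.relSys.Dom) (φ : Unit) : (toyP X).Major192 toyK (fun p => toyTerm X p φ) := by
  intro p hp
  have hp' : p = (Finset.univ, ∅) := Finset.mem_singleton.1 hp
  subst hp'
  have h0 : 0 ≤ toyK.θ ^ (Finset.univ : Finset Unit).card := pow_nonneg B16Ineq197.Consts.θ_pos.le _
  simp only [toyTerm, Finset.prod_empty, Finset.sum_empty, Real.exp_zero, mul_one, Complex.norm_real, Real.norm_eq_abs,
    abs_of_nonneg h0, le_refl]

/-- **NON-VACUITY OF `ineq197_window`** (one window, WL = W): on the toy window every domain X has the model `toyM X`, the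
clauses `toy_clauses` and `toy_small` hold with b01's genuine constants, the size reading `dX = d_rel(X)` is by definition,
the term is the nonzero (1.92) majorant, the selector facts hold (Z = ∅: no domain meets the large field, and q = 1 ≥ 1);
the theorem then yields `B16.Ineq197` for the toy activities `F(X) = θ`. [folklore] -/
theorem toy_ineq197 :
    B16.Ineq197 toyW.relSys (fun _ => (Set.univ : Set Unit)) (fun X φ => ∑ p ∈ (toyP X).adm, toyTerm X p φ)
      toyK.p0 toyK.α toyK.β toyK.κ :=
  ineq197_window toyW toyW (fun _ => (Set.univ : Set Unit)) toyP toyK toy_small toy_clauses toyM (fun _ => rfl) toyTerm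
    (fun X φ => ∑ p ∈ (toyP X).adm, toyTerm X p φ) (fun _ _ _ => rfl) (fun X φ _ => toy_major X φ)
    (fun X hX => by
      obtain ⟨c, hc⟩ := hX
      rw [Finset.mem_inter, toyW_Z] at hc
      exact absurd hc.2 (Finset.notMem_empty c))
    (fun X _ p hp => by
      rw [Finset.mem_singleton.1 hp]
      exact ⟨(), Finset.mem_univ _⟩)

end Toy

end

end Literature.MathematicalPhysics.QuantumFieldTheory.Balaban1983to89.B16Ineq197Window
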